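import Literature.Barriers.CriticalPhenomena.RigorousRGSmallParameterKochWittwer
import Literature.Probability.Distributions.GaussianMoments
import HarnessLib

/-!
# `KochWittwer1994_thm11` reduced to a fixed measure of the block-spin map with free tilt
# (Koch–Wittwer 1991, Theorem 1.4), and the proof route for its discharge

Companion of `RigorousRGSmallParameterKochWittwer.lean`, which vendors the named fact
`Literature.Barriers.CriticalPhenomena.KochWittwer1994_thm11`: Dyson's hierarchical block-spin
transformation `HierarchicalRG.rgMap (2^{1/3})` (`d = 3`: block factor `√c/2 = 2^{-5/6}`, tilt
`e^{(β(c)/2)x²}`, `β(c) = 1/c - 1/2`, normalised) has a probability fixed point which is not a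
centred Gaussian. This file is theorem-only.

## What is proved here

* `HierarchicalRG.tilted_smul_measure`, `HierarchicalRG.blockTilt_smul`,
  `HierarchicalRG.blockTilt_map_const_mul` — the two invariances
  of the map `ν ↦ ((ν ∗ ν).map (s·)).tilted (κx²)`: it forgets a finite non-zero scalar factor of
  `ν`, and the dilation `ν ↦ ν.map (b·)` conjugates tilt `κ` to tilt `κb²` (Koch–Wittwer: "any two
  transformations of the type (1.1) are conjugate via a scaling of the form `h ↦ ah(b·)`",
  [KochWittwer1994, p. 628]; [KochWittwer1991, §1 Remarks, (1.11)]).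
* `HierarchicalRG.sqrt_two_rpow_third_div_two` (`√(2^{1/3})/2 = 2^{-5/6}`),
  `HierarchicalRG.beta_two_rpow_third_pos` (`β(2^{1/3})/2 > 0`).
* **`KochWittwer1994_thm11_of_fixedMeasure`** (and the primed form with block factor `2^{-5/6}`):
  `KochWittwer1994_thm11` follows from the existence of ONE finite non-zero measure `ν` on `ℝ`
  with `((ν ∗ ν).map (2^{-5/6}·)).tilted (t x²) = ν/ν(ℝ)` for SOME `t > 0`, whose moments violate
  the centred-Gaussian identity, `ν(ℝ)·m₄ ≠ 3m₂²` (this excludes `N(0,v)` for every `v ≥ 0`,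
  `δ₀ = N(0,0)` included, and is dilation invariant). No integrability hypothesis is needed: a
  non-integrable tilt returns the junk value `0 ≠ ν/ν(ℝ)`.

## Where the hypothesis comes from: Koch–Wittwer 1991, not 1994 (recorded for the discharge)

The measure-level statement vendored as `KochWittwer1994_thm11` is, up to the conjugations
below, **Theorem 1.4 of [KochWittwer1991]** (Koch–Wittwer, *On the renormalization group
transformation for scalar hierarchical models*, CMP 138 (1991) 537–568): "The equation
`H_IR ∗ g_HT = g_IR` defines a positive measure `H_IR ∈ C₀'(ℝ)`, and this measure is a (nontrivial)
fixed point of the transformation `ℛ`" — `ℛ` being Dyson's transformation (1.7) = [KochWittwer1994,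
(1.1)] extended to finite measures by (1.9), `g_HT(t) = √2 e^{-t²}`, `g_IR = g_HT f_IR`, and `f_IR`
the non-Gaussian fixed point (Theorem 1.1 there) of
`𝒩(f)(t) = (π(1-β²))^{-1/2} ∫ ds e^{-s²/(1-β²)} f(βt + s)²`, `β = 2^{-5/6}` ((1.1), `N = 2`).
Its proof is an ORDINARY proof: §2 (the spaces `B_ρ = {f : Σ|f_n|ρⁿ < ∞}` of even entire functions
in the Hermite coordinates (2.16), the coefficient formula (2.17)–(2.18) of `A(f)g`, `𝒩(f) = A(f)f`,
and the bound `‖A(f)g‖_r ≤ ‖f‖_ρ‖g‖_ρ` for `ρ ≥ β + 2β²r`, Lemma 2.7), §3 (Theorem 3.7: a fixed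
point in `G ⊕ H ⊂ B_ρ`, `ρ > β/(1-2β²) ≈ 1.5167`, near the explicit degree-six polynomial
`p = (0.909, 0.492, 0.251, 0.112, 0.045, 0.016, 0.005)` — a contraction for the tail `h` given the
head `g` (Proposition 3.4) and BROUWER's theorem in `ℝ⁷` for the head (Proposition 3.6), under five
numerical inequalities (N1)–(N5)), §5 ((N1)–(N5) verified in printed decimal tables 1–14: "To check
this proof, the only skill needed is the ability to correctly add and multiply simple floating
point numbers; and no particular computing tool is required"), and §4, proof of Theorem 1.4
(`f_IR = 𝒩^k(f_IR)` exhibits `f_IR(i·)` as a limit of positive-definite functions, (4.11)–(4.13);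
BOCHNER's theorem; finiteness by monotone convergence; `ℛ(H_IR) = H_IR` through the conjugacy
(F2) `J ∘ ℛ = 𝒯 ∘ J`, (4.14), and Fourier uniqueness). The 1994 paper adds REGULARITY — the fixed
measure has an even entire density `h_IR` with `0 < h_IR(t) < c₁e^{-c₂t⁶}` ([KochWittwer1994,
Theorem 1.1]) — and THAT is the computer-assisted part (its Theorem 3.2, proved in their MPEJ 1995
paper [8]); the vendored statement does not include it. Both external theorems of the 1991 route
are in the tree: `Literature.Topology.Euclidean.Brouwer.exists_fixedPoint_closedBall` and
`Literature.Analysis.FunctionSpaces.bochner_holds` (with Mathlib's Prokhorov theorem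
`isCompact_closure_of_isTightMeasureSet`, which can replace Bochner here, see Phase III).

### Dictionary (transcriber's computation; the constants are checked against both papers)

Write `B_{s,κ}(ν) = ((ν ∗ ν).map (s·)).tilted (κx²)` (so `rgMap c = B_{√c/2, β(c)/2}`) and
`B♮_{s,κ}(ν) = e^{κx²}·((ν ∗ ν).map (s·))` for the unnormalised map; `L_ν(t) = ∫ e^{tx} dν`.
* Laplace side: for `X, X'` i.i.d. `~ ν` and `Z ~ N(0,1)`, `e^{κ y²} = E e^{(2κ)^{1/2} y Z}` and
  Fubini give `L_{B♮_{s,κ}ν}(t) = E[L_ν(st + s(2κ)^{1/2} Z)²]`. With `s = β = 2^{-5/6}` and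
  `κ = λ := (1-β²)/(4β²)` this is Koch–Wittwer's `𝒩(L_ν)(t) = E[L_ν(βt + ϰZ)²]`,
  `ϰ² = (1-β²)/2` (the Gaussian `e^{-s²/(1-β²)}ds` of (1.1) has variance `(1-β²)/2`): **a measure
  `ν` with `L_ν = f_IR` is a fixed point of `B♮_{β,λ}`**, hence `B_{β,λ}(ν) = ν/ν(ℝ)` — the
  hypothesis `hfix` of the reduction with `t = λ = (2^{5/3} - 1)/4 ≈ 0.5437`, while
  `β(2^{1/3})/2 = (2^{-1/3} - 1/2)/2 ≈ 0.1469` (dilation `b² ≈ 3.70`).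
* `ℛ` versus `B`: by (1.9), `ℛ(H)` is the image of `e^{-(γ/2)(x-y)²} dH(x)dH(y)` under
  `(x,y) ↦ (x+y)/(2ϑ)`, `1/(2ϑ) = β`; since `-(γ/2)(x-y)² = -γx² - γy² + (γ/2)(x+y)²`, the measure
  `G = e^{-γx²}H` satisfies `e^{-γx²}ℛ(H) = B♮_{β, γ(1-2β²)/(2β²)}(G)`: Koch–Wittwer's fixed
  measure `H_IR` of `ℛ` is `e^{γx²}` times a fixed measure of `B♮`, and `g_IR = H_IR ∗ g_HT` is
  Gallavotti's picture (F1)–(F2). The discharge never needs `ℛ` or `𝒯`: it produces `ν` with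
  `L_ν = f_IR` directly (Phase III) and feeds `KochWittwer1994_thm11_of_fixedMeasure'`.
* Taylor side: for `f(t) = Σ_n a_n t^{2n}` (so `a_n = m_{2n}(ν)/(2n)!` when `f = L_ν`),
  `(𝒩a)_n = β^{2n} Σ_{i ≥ 0} [(2n+2i)!/((2n)! i!)] ((1-β²)/4)^i q_{n+i}`, `q_N = Σ_{j ≤ N} a_j a_{N-j}`
  (binomial expansion of `(βt + ϰZ)^{2N}`, `E Z^{2i} = (2i-1)!!`); all weights are positive. This
  is the `d = 3` analogue of the tree's (5.4)–(5.7) (`RigorousRGSmallParameterHHWTaylorRecursion`).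
* Non-Gaussianity: in Taylor coordinates the moment hypothesis reads `2a₀a₂ ≠ a₁²`.

### Route to `KochWittwer1994_thm11_holds` (triage XL; nothing below is proved in this file)

* Phase I — Theorem 3.7 as printed, in the SEQUENCE space `B_ρ` (no function spaces): the
  bilinear map `A` by formula (2.18), Lemma 2.7, Lemmas 3.1–3.2 (the monotonicity reductions
  (3.12)–(3.19)), Proposition 3.4 (Banach), Proposition 3.6 (Brouwer on the box `G`, from
  `exists_fixedPoint_closedBall` by composing with the coordinatewise retraction onto the box),
  with (N1)–(N5) and Tables 1–14 entered as rational inequalities (`norm_num`); `2^{-1/6}`,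
  `2^{-1/3}`, `ρ` through the printed enclosures (I1)–(I3). Then the bootstrap of Lemma 4.1:
  `f* = A(f*)f* ∈ B_r` for every `r` (iterate `r ↦ (r - β)/(2β²)`, Lemma 2.7), which makes every
  change of coordinates below absolutely convergent.
* Phase II — from coefficients to the function: `F(t) = Σ f*_n βⁿ He_{2n}(√2 t)/((2n)!)^{1/2}`
  ((2.16); `p_n = He_n(√2·)`, probabilists' Hermite, Mathlib `Polynomial.hermite`), equivalently
  its Taylor series; `F = 𝒩F` on `ℝ` needs exactly two polynomial identities — the eigenrelation
  `E[p_n(βt + ϰZ)] = βⁿ p_n(t)` (induction on `n` with `x He_n = He_{n+1} + n He_{n-1}` and the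
  Gaussian integration by parts `E[Z q(Z)] = E[q'(Z)]`, using `2ϰ² = 1 - β²`) and the linearization
  `He_a He_b = Σ_j j! C(a,j) C(b,j) He_{a+b-2j}` (induction on `b`), which together give (2.17)–(2.20)
  — plus dominated convergence from the decay of Phase I.
* Phase III — the measure (KW §4 without Bochner): if `F(t) = e^{-ct²} L_ρ(t)` for a finite
  measure `ρ ≥ 0` and `c ≥ 0` then, completing the square in the Gaussian variable,
  `𝒩F(t) = e^{-c't²} L_{ρ'}(t)` with `c' = 2cβ²/(1 + 2c(1-β²)) < c` and `ρ' ≥ 0` an explicit image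
  of `e^{q x²}(ρ ∗ ρ)` (`q = ϰ²/(2(1 + 2c(1-β²)))`), finite because `𝒩F(0) = F(0) < ∞`. Hence
  `F = e^{-c_k t²} L_{ρ_k}`, `c_k ↓ 0` (`c' ≤ 2β²c`),
  `ρ_k(ℝ) = F(0)`, with `L_{ρ_k}(t) ≤ e^{c₁t²}F(t)` uniformly in `k`: the `ρ_k/F(0)` are tight,
  a subsequence converges weakly (Mathlib `isCompact_closure_of_isTightMeasureSet`), exponential
  moments pass to the limit by uniform integrability, and the limit `ν̄` has `L_{ν̄} = F/F(0)`
  (the base case: `c₁ = β²/(1-β²)` and `ρ₁` the image under `u ↦ βu/ϰ²` of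
  `(π(1-β²))^{-1/2} e^{-u²/(1-β²)} F(u)² du`, is (1.1) itself after completing the square).
  Then `L_{B♮ν̄} = 𝒩(L_ν̄) = L_ν̄/F(0)` everywhere on `ℝ`, and two finite measures on `ℝ` with equal,
  everywhere finite Laplace transforms are equal (Mathlib `ProbabilityTheory.eqOn_complexMGF_of_mgf'`
  with `Measure.ext_of_complexMGF_id_eq`), so `B_{β,λ}(ν̄) = ν̄`.
* Phase IV — this file: `KochWittwer1994_thm11_of_fixedMeasure'` with `t = λ`, the moment
  hypothesis from the box `G` (`2a₀a₂/a₁² ≈ 0.83`).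

Numerical record (non-rigorous double precision, Newton's method on the Taylor side truncated at
30 coefficients, residual `10⁻¹⁶`; session notes 2026-08-15): `a₀…a₆ = 0.752860, 0.248353,
0.0340872, 0.00269924, 1.42385·10⁻⁴, 5.4351·10⁻⁶, 1.5851·10⁻⁷`, `a₃₀ ≈ 4·10⁻⁶³`; in Koch–Wittwer's
coordinates `f₀…f₇ = 0.90879, 0.49192, 0.25117, 0.11225, 0.04451, 0.01591, 0.00520, 0.00157` —
inside the printed box `p ± δ` of (3.21) and matching `(Q(p)p)_k` of Table 10 to three decimals.
No computation is needed for the discharge beyond re-checking the printed tables.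

## References

* [KochWittwer1991] H. Koch, P. Wittwer, Commun. Math. Phys. 138 (1991) 537–568: (1.1),
  (1.6)–(1.11), Theorems 1.1, 1.4, Lemmas 2.5, 2.7, (2.16)–(2.18), §3 (Propositions 3.4, 3.6,
  Theorem 3.7, (3.20)–(3.21)), §4 (Lemma 4.1, (4.11)–(4.14)), §5 (Tables 1–14).
* [KochWittwer1994] H. Koch, P. Wittwer, Commun. Math. Phys. 164 (1994) 627–647: (1.1)–(1.6),
  Theorem 1.1, p. 628 (scaling conjugacy), Theorems 3.1–3.2.
* [HaraHattoriWatanabe2001] T. Hara, T. Hattori, H. Watanabe, Commun. Math. Phys. 220 (2001)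
  13–40, §1 (1.1)–(1.4) (the normalisation of `HierarchicalRG.rgMap`).
-/

noncomputable section

namespace Literature.Barriers.CriticalPhenomena

open _root_.MeasureTheory _root_.ProbabilityTheory _root_.Set
open scoped _root_.ENNReal _root_.NNReal

namespace HierarchicalRG

/-! ### Normalisation and scaling invariances of the tilted block-spin map -/

/-- Tilting forgets a (finite, non-zero) scalar factor: `(r • μ).tilted f = μ.tilted f`
(the normaliser scales by the same factor). [folklore] -/
theorem tilted_smul_measure {α : Type*} [MeasurableSpace α] (μ : Measure α) (f : α → ℝ)
    {r : ℝ≥0∞} (hr0 : r ≠ 0) (hr : r ≠ ∞) : (r • μ).tilted f = μ.tilted f := by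
  rw [Measure.tilted, Measure.tilted, withDensity_smul_measure, integral_smul_measure,
    ← withDensity_smul' _ _ hr]
  congr 1
  funext x
  have hrr : 0 < r.toReal := ENNReal.toReal_pos hr0 hr
  have hr' : r = ENNReal.ofReal r.toReal := (ENNReal.ofReal_toReal hr).symm
  simp only [Pi.smul_apply, smul_eq_mul]
  generalize hρ : r.toReal = ρ at hrr hr'
  rw [hr', ← ENNReal.ofReal_mul hrr.le]
  congr 1
  by_cases hZ : (∫ x, Real.exp (f x) ∂μ) = 0
  · simp [hZ]
  · field_simp

/-- **Normalisation invariance of the block-spin map**: the tilted law of the rescaled pair sum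
does not see a finite non-zero scalar factor of the single-spin measure. [folklore] -/
theorem blockTilt_smul (ν : Measure ℝ) [SFinite ν] (s : ℝ) (f : ℝ → ℝ) {r : ℝ≥0∞}
    (hr0 : r ≠ 0) (hr : r ≠ ∞) :
    (((r • ν) ∗ (r • ν)).map (fun x => s * x)).tilted f = ((ν ∗ ν).map (fun x => s * x)).tilted f := by
  rw [Measure.conv_smul_left, Measure.conv_smul_right, Measure.map_smul, Measure.map_smul,
    smul_smul, tilted_smul_measure _ _ (mul_ne_zero hr0 hr0) (ENNReal.mul_ne_top hr hr)]

/-- **Scaling conjugacy of the block-spin map** (Koch–Wittwer: "any two transformations of the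
type (1.1) are conjugate via a scaling of the form `h ↦ ah(b·)`"): dilating the single-spin law by
`b` conjugates the map with tilt `κ x²` to the map with tilt `κ b² x²`.
[cite: KochWittwer1994, §1 p. 628 (after Theorem 1.1)] [cite: KochWittwer1991, §1 Remarks, eq. (1.11)] -/
theorem blockTilt_map_const_mul (ν : Measure ℝ) [SFinite ν] (s κ b : ℝ) :
    (((ν.map (fun x => b * x)) ∗ (ν.map (fun x => b * x))).map (fun x => s * x)).tilted
        (fun x => κ * x ^ 2)
      = ((((ν ∗ ν).map (fun x => s * x)).tilted (fun x => κ * b ^ 2 * x ^ 2)).map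
          (fun x => b * x)) := by
  have hL : (fun x : ℝ => b * x) = (AddMonoidHom.mulLeft b : ℝ → ℝ) := by
    funext x; simp
  have hconv : (ν.map (fun x => b * x)) ∗ (ν.map (fun x => b * x)) = (ν ∗ ν).map (fun x => b * x) := by
    rw [hL, ← Measure.map_conv_addMonoidHom]
    rw [← hL]; fun_prop
  rw [hconv, Measure.map_map (by fun_prop) (by fun_prop)]
  have hcomm : ((fun x : ℝ => s * x) ∘ fun x : ℝ => b * x) = ((fun x : ℝ => b * x) ∘ fun x : ℝ => s * x) := by
    funext x; simp only [Function.comp_apply]; ring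
  rw [hcomm, ← Measure.map_map (by fun_prop) (by fun_prop)]
  have hg : (fun x : ℝ => κ * b ^ 2 * x ^ 2) = (fun x : ℝ => κ * x ^ 2) ∘ fun x : ℝ => b * x := by
    funext x; simp only [Function.comp_apply]; ring
  rw [hg]
  -- push-forward commutes with tilting by a pulled-back density (change of variables; the tree's
  -- `Literature.Probability.LatticeModels.map_tilted_comp`, inlined to keep the imports minimal)
  have hΦ : Measurable fun x : ℝ => b * x := by fun_prop
  have hg' : Measurable fun x : ℝ => κ * x ^ 2 := by fun_prop
  symm
  refine Measure.ext fun S hS => ?_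
  rw [Measure.map_apply hΦ hS, tilted_apply' _ _ (hΦ hS), tilted_apply' _ _ hS,
    integral_map hΦ.aemeasurable hg'.exp.aestronglyMeasurable, setLIntegral_map hS (by fun_prop) hΦ]
  rfl

/-- `d = 3`: the block factor `√c/2` of `rgMap c` at `c = 2^{1/3}` is Koch–Wittwer's
`β = 2^{-5/6}` (`= 1/(2α)`, `α = 2^{-1/6}`). [cite: KochWittwer1994, §1 eqs. (1.2), (1.6)] -/
theorem sqrt_two_rpow_third_div_two :
    Real.sqrt ((2 : ℝ) ^ ((1 : ℝ) / 3)) / 2 = (2 : ℝ) ^ (-(5 : ℝ) / 6) := by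
  rw [Real.sqrt_eq_rpow, ← Real.rpow_mul (by norm_num : (0 : ℝ) ≤ 2)]
  rw [show (-(5 : ℝ) / 6) = (1 / 3 * (1 / 2)) + (-1) by norm_num,
    Real.rpow_add (by norm_num : (0 : ℝ) < 2), Real.rpow_neg_one]
  ring

/-- `d = 3`: the tilt `β(c)/2 = (2^{-1/3} - 1/2)/2` of `rgMap (2^{1/3})` is positive (`2^{1/3} < 2`).
[cite: HaraHattoriWatanabe2001, §1 eqs. (1.1), (1.4)] -/
theorem beta_two_rpow_third_pos : 0 < beta ((2 : ℝ) ^ ((1 : ℝ) / 3)) / 2 := by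
  have h2 : (2 : ℝ) ^ ((1 : ℝ) / 3) < 2 := by
    have := Real.rpow_lt_rpow_of_exponent_lt (by norm_num : (1 : ℝ) < 2)
      (by norm_num : (1 : ℝ) / 3 < 1)
    simpa using this
  have h0 : 0 < (2 : ℝ) ^ ((1 : ℝ) / 3) := by positivity
  unfold beta
  have : 1 / 2 < 1 / (2 : ℝ) ^ ((1 : ℝ) / 3) := by
    rw [div_lt_div_iff_of_pos_left (by norm_num) (by norm_num) h0]; exact h2
  linarith

end HierarchicalRG

open HierarchicalRG

/-- **Reduction (Koch–Wittwer 1991, Theorem 1.4 ⟹ `KochWittwer1994_thm11`).** If some finite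
non-zero measure `ν` on `ℝ` is fixed, up to normalisation, by the block-spin map with the `d = 3`
block factor `√c/2 = 2^{-5/6}` and ANY positive Gaussian tilt `e^{t x²}`, `t > 0`, and if its
moments violate the centred-Gaussian identity `m₄ = 3 m₂²`, then Dyson's hierarchical
transformation `HierarchicalRG.rgMap (2^{1/3})` has a non-Gaussian probability fixed point: the
normalised law dilated by `b = (t / (β(c)/2))^{1/2}` (scaling conjugacy `blockTilt_map_const_mul`,
normalisation invariance `blockTilt_smul`); it is not `N(0, v)`, whose dilations all satisfy
`m₄ = 3m₂²` (`v = 0` included). [cite: KochWittwer1991, Theorem 1.4 and §1 Remarks (1.11)]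
[cite: KochWittwer1994, Theorem 1.1 and §1 p. 628] -/
theorem KochWittwer1994_thm11_of_fixedMeasure (ν : Measure ℝ) [IsFiniteMeasure ν] (hν : ν ≠ 0)
    {t : ℝ} (ht : 0 < t)
    (hfix : ((ν ∗ ν).map (fun x => Real.sqrt ((2 : ℝ) ^ ((1 : ℝ) / 3)) / 2 * x)).tilted
        (fun x => t * x ^ 2) = (ν univ)⁻¹ • ν)
    (hm4 : (ν univ).toReal * ∫ x, x ^ 4 ∂ν ≠ 3 * (∫ x, x ^ 2 ∂ν) ^ 2) :
    KochWittwer1994_thm11 := by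
  -- notation
  set c : ℝ := (2 : ℝ) ^ ((1 : ℝ) / 3) with hc
  set s : ℝ := Real.sqrt c / 2 with hs
  set κ : ℝ := beta c / 2 with hκ
  have hκpos : 0 < κ := beta_two_rpow_third_pos
  -- the normalised law
  have hZ0 : ν univ ≠ 0 := by rwa [Ne, Measure.measure_univ_eq_zero]
  have hZtop : ν univ ≠ ∞ := measure_ne_top ν univ
  haveI : NeZero ν := ⟨hν⟩
  set νbar : Measure ℝ := (ν univ)⁻¹ • ν with hνbar
  haveI : IsProbabilityMeasure νbar := isProbabilityMeasureSMul
  have hfix' : ((νbar ∗ νbar).map (fun x => s * x)).tilted (fun x => t * x ^ 2) = νbar := by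
    rw [hνbar, blockTilt_smul ν s _ (ENNReal.inv_ne_zero.2 hZtop) (ENNReal.inv_ne_top.2 hZ0)]
    exact hfix
  -- the dilation matching the tilt
  set b : ℝ := Real.sqrt (t / κ) with hb
  have hbpos : 0 < b := Real.sqrt_pos.2 (div_pos ht hκpos)
  have hκb : κ * b ^ 2 = t := by
    rw [hb, Real.sq_sqrt (div_pos ht hκpos).le]; field_simp
  set μ : Measure ℝ := νbar.map (fun x => b * x) with hμ
  haveI : IsProbabilityMeasure μ := Measure.isProbabilityMeasure_map (by fun_prop)
  refine ⟨μ, inferInstance, ?_, ?_⟩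
  · -- fixed point
    show ((μ ∗ μ).map (fun x => Real.sqrt c / 2 * x)).tilted (fun x => beta c / 2 * x ^ 2) = μ
    rw [hμ, blockTilt_map_const_mul νbar s κ b, hκb, hfix']
  · -- not Gaussian
    intro v hv
    apply hm4
    have hback : νbar = μ.map (fun x => b⁻¹ * x) := by
      rw [hμ, Measure.map_map (by fun_prop) (by fun_prop)]
      have : ((fun x : ℝ => b⁻¹ * x) ∘ fun x : ℝ => b * x) = id := by
        funext x; simp [hbpos.ne']
      rw [this, Measure.map_id]
    rw [hv, gaussianReal_map_const_mul, mul_zero] at hback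
    obtain ⟨v', hback'⟩ : ∃ v' : ℝ≥0, νbar = gaussianReal 0 v' := ⟨_, hback⟩
    have hνeq : ν = (ν univ) • νbar := by
      rw [hνbar, smul_smul, ENNReal.mul_inv_cancel hZ0 hZtop, one_smul]
    have hsm : ∀ k : ℕ, ∫ x, x ^ k ∂ν = (ν univ).toReal * ∫ x, x ^ k ∂(gaussianReal 0 v') := by
      intro k
      conv_lhs => rw [hνeq]
      rw [integral_smul_measure, hback', smul_eq_mul]
    have h2 : ∫ x, x ^ 2 ∂ν = (ν univ).toReal * (v' : ℝ) := by
      rw [hsm 2]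
      have := Literature.Probability.Distributions.integral_pow_even_gaussianReal v' 1
      simp only [mul_one, pow_one] at this
      rw [this]
      norm_num [Nat.doubleFactorial]
    have h4 : ∫ x, x ^ 4 ∂ν = (ν univ).toReal * (3 * (v' : ℝ) ^ 2) := by
      rw [hsm 4]
      have := Literature.Probability.Distributions.integral_pow_even_gaussianReal v' 2
      rw [show (2 * 2 : ℕ) = 4 by norm_num] at this
      have h3 : ((Nat.doubleFactorial (4 - 1) : ℕ) : ℝ) = 3 := by norm_num [Nat.doubleFactorial]
      rw [this, h3]
      ring
    rw [h2, h4]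
    ring

/-- The same reduction with the block factor written as Koch–Wittwer's `β = 2^{-5/6}`
(`sqrt_two_rpow_third_div_two`). [cite: KochWittwer1991, Theorem 1.4] [cite: KochWittwer1994, Theorem 1.1, (1.2), (1.6)] -/
theorem KochWittwer1994_thm11_of_fixedMeasure' (ν : Measure ℝ) [IsFiniteMeasure ν] (hν : ν ≠ 0)
    {t : ℝ} (ht : 0 < t)
    (hfix : ((ν ∗ ν).map (fun x => (2 : ℝ) ^ (-(5 : ℝ) / 6) * x)).tilted
        (fun x => t * x ^ 2) = (ν univ)⁻¹ • ν)
    (hm4 : (ν univ).toReal * ∫ x, x ^ 4 ∂ν ≠ 3 * (∫ x, x ^ 2 ∂ν) ^ 2) :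
    KochWittwer1994_thm11 :=
  KochWittwer1994_thm11_of_fixedMeasure ν hν ht (by rwa [sqrt_two_rpow_third_div_two]) hm4

end Literature.Barriers.CriticalPhenomena

end
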